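import Summits.QuantumAdvantage.AdviceFreeQNC0.SqrtDegreeStatements
import Summits.QuantumAdvantage.AdviceFreeQNC0.WalkTubeRank
import Summits.QuantumAdvantage.AdviceFreeQNC0.WalkTubeMass
import Summits.QuantumAdvantage.AdviceFreeQNC0.BinomialTailLower
import Summits.QuantumAdvantage.AdviceFreeQNC0.WalkTransport
import HarnessLib

/-!
# Cell qa-qnc0 (rung F-Q1-exp inputs): walk and ring hardness at `𝔽₂`-degree `K·⌊√n⌋`, unconditionally

Planner qa-qnc0-p2 g12, ROUND-12 §A.3 / `Sketch12b.lean` §2 and §6 (statements **E1 `WalkHardLinSqrt`**,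
**E2 `RingHardLinSqrt p`**, **P1 `WalkHardLinSqrtPlan`**, **P2 `RingHardLinSqrtPlan`** typed verbatim in
`SqrtDegreeStatements.lean`): the proofs.
What α's proof (the tube bound, ROUND-11) really gives: `tubePlan` uses the degree only through
`D ≤ ⌊√n⌋`, so the same three estimates give hardness at every slope-`K` square-root degree:

* `walkHardLinSqrtPlan : TubeMass → BinomTailLower → WalkHardLinSqrt` — the re-run of
  `WalkTubeRank.tubePlan` with `(log₂ n)^C` replaced by `K·⌊√n⌋`: `BinomTailLower (C₁ + K)` instead of `(C₁ + 1)`,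
  threshold `n ≥ 4(C₁ + K)²` instead of `logPow_le_natSqrt`; `D' = n/2 − C₁⌊√n⌋ − K⌊√n⌋`, the strategy's
  `𝔽₄`-function fails on `≥ |FAR_{D'+D}|·N_{D'}/2^n ≥ (c/2)·2^n` inputs (`tubeBound`, landed); `θ_K = 1 − c_K/2`.
* `ringHardLinSqrtPlan : WalkHardLinSqrt → RingHardLinSqrt 2` — the re-run of
  `WalkTransport.ringHard_two_of_walkHard`: the chart `u = uVec x` of the odd class is `𝔽₂`-affine
  (`hasDeg_transport` keeps the degree), bookkeeping `K·⌊√(n+1)⌋ ≤ (K+1)·⌊√n⌋` for `n ≥ K²`; the even class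
  gives `2ⁿ`; `θ = (1 + θ'_{K+1})/2`.
* **`walkHardLinSqrt : WalkHardLinSqrt`** and **`ringHardLinSqrt_two : RingHardLinSqrt 2`** — UNCONDITIONAL, from the
  landed `tubeMass` (p551349) and `binomTailLower` (p549712).

`RingHardLinSqrt 2` is the ring-side input of the exponential bridge (`ExpBridge.lean`:
`LongGridCycle → RingHardLinSqrt p → HLFNotFAC0ModExp p`), i.e. of rung F-Q1-exp (2D HLF versus
exponential-size `AC⁰[2]/rpoly`, no advice) and of F-Q1⁺ (Grewal–Kumar 2024 §1.3 Q5 for `p = 2`).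

WHAT THIS IS NOT: nothing for odd `p` (the chart is `𝔽₂`-only); no circuit statement (that is the bridge);
the constants `θ_K` are not optimised; separation NOT moved.
-/

noncomputable section

namespace Summit.QuantumAdvantage.AdviceFreeQNC0

open Classical
open Finset Literature.Computability.QuantumComplexity Literature.Computability.QuantumComplexity.RingHLF
open Literature.Computability.MetaComplexity Literature.Computability.MetaComplexity.Smolensky

/-! ### P1: the tube bound at degree `K·⌊√n⌋` -/

open TubePlanProof in
/-- **P1 `WalkHardLinSqrtPlan` — PROVED** (re-run of `tubePlan`): with `C₁, m₀` from `TubeMass`, `c, m₁` from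
`BinomTailLower` at `C₁ + K`, `θ_K = 1 − c/2`; for `n ≥ max(m₀, m₁, 4(C₁+K)²)`, `D = K⌊√n⌋`,
`D' = n/2 − C₁⌊√n⌋ − D ≥ 0`, the walk strategy's function `stratFun ch y ∈ M_D` fails on
`≥ |FAR_{D'+D}|·N_{D'}/2^n ≥ (c/2)·2^n` inputs (`tubeBound`). -/
theorem walkHardLinSqrtPlan : WalkHardLinSqrtPlan := by
  intro hTM hBT K
  obtain ⟨C₁, m₀, hmass⟩ := hTM
  obtain ⟨c, hc, m₁, htail⟩ := hBT (C₁ + K)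
  refine ⟨1 - c / 2, by linarith, max (max m₀ m₁) (4 * (C₁ + K) ^ 2), fun n hn ch y hy => ?_⟩
  have hm₀ : m₀ ≤ n := le_trans (le_trans (le_max_left _ _) (le_max_left _ _)) hn
  have hm₁ : m₁ ≤ n := le_trans (le_trans (le_max_right _ _) (le_max_left _ _)) hn
  have hbig : 4 * (C₁ + K) ^ 2 ≤ n := le_trans (le_max_right _ _) hn
  set s := Nat.sqrt n with hs
  set D := K * s with hD
  have hs2 : 2 * (C₁ + K) ≤ s := by
    rw [hs, Nat.le_sqrt]
    nlinarith
  have hss : s * s ≤ n := Nat.sqrt_le n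
  have hfit2 : 2 * (D + C₁ * s) ≤ n := by nlinarith
  have hfit : D + C₁ * s ≤ n / 2 := by omega
  set D' := n / 2 - C₁ * s - D with hD'
  have hsum : D' + D = n / 2 - C₁ * s := by omega
  have ht : n / 2 - (C₁ * s + D) = D' := by omega
  have htle : C₁ * s + D ≤ (C₁ + K) * s := by nlinarith
  -- the three inputs
  have hf : stratFun ch y ∈ fullSpan n D := stratFun_mem_fullSpan ch y hy
  have h₃ := tubeBound n D D' (stratFun ch y) hf
  rw [hsum] at h₃
  have h₄ := hmass n hm₀
  have h₅ := htail n hm₁ (C₁ * s + D) htle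
  rw [ht] at h₅
  -- combine
  set FAR := (farSet n (n / 2 - C₁ * s)).card with hFAR
  set N := numMonomials n D' with hN
  set FAIL := (failSetOf (stratFun ch y)).card with hFAIL
  have h2n : (0 : ℝ) < (2 : ℝ) ^ n := by positivity
  have h₃R : (FAR : ℝ) * N ≤ (2 : ℝ) ^ n * FAIL := by exact_mod_cast h₃
  have h₄R : (2 : ℝ) ^ n ≤ 2 * FAR := by exact_mod_cast h₄
  have hfail : c / 2 * (2 : ℝ) ^ n ≤ FAIL := by
    have step1 : (2 : ℝ) ^ n / 2 * (c * (2 : ℝ) ^ n) ≤ (FAR : ℝ) * N :=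
      mul_le_mul (by linarith) h₅ (by positivity) (Nat.cast_nonneg _)
    have step2 : (2 : ℝ) ^ n * (c / 2 * (2 : ℝ) ^ n) ≤ (2 : ℝ) ^ n * FAIL := by
      calc (2 : ℝ) ^ n * (c / 2 * (2 : ℝ) ^ n) = (2 : ℝ) ^ n / 2 * (c * (2 : ℝ) ^ n) := by ring
        _ ≤ (FAR : ℝ) * N := step1
        _ ≤ (2 : ℝ) ^ n * FAIL := h₃R
    exact le_of_mul_le_mul_left step2 h2n
  have hwin := card_win_add_card_failSetOf ch y
  have hwinR : ((univ.filter fun u : Fin n → Bool => ringWinU ch y u = true).card : ℝ) + FAIL =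
      (2 : ℝ) ^ n := by
    rw [hFAIL]; exact_mod_cast hwin
  linarith

/-- **E1 `WalkHardLinSqrt` — PROVED UNCONDITIONALLY** (the landed `tubeMass`, `binomTailLower`). -/
theorem walkHardLinSqrt : WalkHardLinSqrt := walkHardLinSqrtPlan tubeMass binomTailLower

/-! ### P2: ring ← walk at degree `K·⌊√n⌋` -/

/-- **P2 `RingHardLinSqrtPlan` — PROVED** (re-run of `WalkTransport.ringHard_two_of_walkHard`): given a ring strategy
`P` of degree `≤ K⌊√(n+1)⌋` at ring length `n + 1`, the transported walk strategy
`y_g(u) = [P_g(xOfU u) = 1] ⊕ t(xOfU u)_g` has degree `≤ (K+1)⌊√n⌋` (for `n ≥ K²`) and wins at `u = uVec x`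
exactly when `P` solves the ring relation at the odd-class pattern `x` (`rel_iff_ringWinU`); the even class
contributes at most `2ⁿ`; `θ = (1 + θ'_{K+1})/2`. -/
theorem ringHardLinSqrtPlan : RingHardLinSqrtPlan := by
  intro hW K
  obtain ⟨θ', hθ', n₀, hn₀⟩ := hW (K + 1)
  refine ⟨(1 + θ') / 2, by linarith, max (n₀ + 1) (max 5 (K * K + 1)), fun N hN P hP => ?_⟩
  obtain ⟨n, rfl⟩ : ∃ n, N = n + 1 := ⟨N - 1, by have := le_max_right (n₀ + 1) (max 5 (K * K + 1)); omega⟩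
  have hn₀n : n₀ ≤ n := by have := le_max_left (n₀ + 1) (max 5 (K * K + 1)); omega
  have hn4 : 4 ≤ n := by
    have := le_trans (le_max_left _ _) (le_trans (le_max_right (n₀ + 1) _) hN); omega
  have hnK : K * K ≤ n := by
    have := le_trans (le_max_right _ _) (le_trans (le_max_right (n₀ + 1) _) hN); omega
  -- degree bookkeeping: `K⌊√(n+1)⌋ ≤ (K+1)⌊√n⌋` and `1 ≤ (K+1)⌊√n⌋`
  have hsq : Nat.sqrt (n + 1) ≤ Nat.sqrt n + 1 := Nat.sqrt_succ_le_succ_sqrt n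
  have hKs : K ≤ Nat.sqrt n := by rw [Nat.le_sqrt]; exact hnK
  have hs1 : 1 ≤ Nat.sqrt n := by rw [Nat.le_sqrt]; omega
  have hdegle : K * Nat.sqrt (n + 1) ≤ (K + 1) * Nat.sqrt n := by nlinarith
  have hone : 1 ≤ (K + 1) * Nat.sqrt n := by nlinarith
  -- the transported walk strategy and its degree
  set z : (Fin (n + 1) → Bool) → (Fin (n + 1) → Bool) := fun x i => decide (P i x = 1) with hz
  set y : Fin (n + 1) → (Fin n → Bool) → Bool :=
    fun g u => xor (z (xOfU u) g) (tGuess (xOfU u) g) with hy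
  have hdeg : ∀ g, HasDeg (y g) ((K + 1) * Nat.sqrt n) := by
    intro g
    have hPg : P g ∈ lowDeg (ZMod 2) (n + 1) ((K + 1) * Nat.sqrt n) := lowDeg_mono hdegle (hP g)
    exact hasDeg_transport hone (P g) hPg g
  have hwin := hn₀ n hn₀n (n + 2) y hdeg
  -- split the solved patterns by the parity of the number of zeros
  set Sx := univ.filter fun x : Fin (n + 1) → Bool => Rel x (z x) with hSx
  set OddZ : (Fin (n + 1) → Bool) → Prop := fun x =>
    (univ.filter fun j : Fin (n + 1) => x j = false).card % 2 = 1 with hOddZ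
  have hsplit : Sx.card = (Sx.filter OddZ).card + (Sx.filter fun x => ¬ OddZ x).card :=
    (Finset.card_filter_add_card_filter_not _).symm
  have heven : (Sx.filter fun x => ¬ OddZ x).card ≤ 2 ^ n := by
    refine le_trans (Finset.card_le_card ?_) card_even_class_le
    intro x hx
    rw [mem_filter] at hx ⊢
    exact ⟨mem_univ _, hx.2⟩
  have hodd : (Sx.filter OddZ).card ≤
      (univ.filter fun u : Fin n → Bool => ringWinU (n + 2) y u = true).card := by
    refine Finset.card_le_card_of_injOn uVec ?_ ?_
    · intro x hx
      rw [Finset.mem_coe, mem_filter, hSx, mem_filter] at hx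
      rw [Finset.mem_coe, mem_filter]
      exact ⟨mem_univ _, (rel_iff_ringWinU (by omega) x hx.2 z).1 hx.1.2⟩
    · intro x₁ hx₁ x₂ hx₂ h
      rw [Finset.mem_coe, mem_filter] at hx₁ hx₂
      rw [← xOfU_uVec (by omega) x₁ hx₁.2, ← xOfU_uVec (by omega) x₂ hx₂.2, h]
  -- arithmetic
  have hS : (Sx.card : ℝ) ≤ 2 ^ n + θ' * 2 ^ n := by
    have h1 : (Sx.card : ℝ) ≤ ((Sx.filter fun x => ¬ OddZ x).card : ℝ) + ((Sx.filter OddZ).card : ℝ) := by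
      rw [hsplit]; push_cast; linarith
    have h2 : ((Sx.filter fun x => ¬ OddZ x).card : ℝ) ≤ 2 ^ n := by exact_mod_cast heven
    have h3 : ((Sx.filter OddZ).card : ℝ) ≤ θ' * 2 ^ n := le_trans (by exact_mod_cast hodd) hwin
    linarith
  have hpow : (2 : ℝ) ^ (n + 1) = 2 * 2 ^ n := by ring
  calc (Sx.card : ℝ) ≤ 2 ^ n + θ' * 2 ^ n := hS
    _ = (1 + θ') / 2 * (2 : ℝ) ^ (n + 1) := by rw [hpow]; ring

/-- **E2 at `p = 2`: `RingHardLinSqrt 2` — PROVED UNCONDITIONALLY.**  For every slope `K` there is `θ_K < 1`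
such that, for all large ring lengths `n`, every tuple of `𝔽₂`-polynomials of degree `≤ K·⌊√n⌋` solves the
ring graph-state relation on at most `θ_K·2ⁿ` measurement patterns. -/
theorem ringHardLinSqrt_two : RingHardLinSqrt 2 := ringHardLinSqrtPlan walkHardLinSqrt

/-- Sanity: `RingHardLinSqrt 2` recovers α's conclusion `RingHard 2` (polylog degrees are `≤ ⌊√n⌋`
eventually, `logPow_le_natSqrt`). -/
theorem ringHard_two_of_linSqrt (h : RingHardLinSqrt 2) : RingHard 2 := by
  obtain ⟨θ, hθ, n₀, hn₀⟩ := h 1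
  refine ⟨θ, hθ, fun c => ?_⟩
  obtain ⟨n₂, hn₂⟩ := TubePlanProof.logPow_le_natSqrt c
  refine ⟨max n₀ n₂, fun n hn P hP => hn₀ n (le_trans (le_max_left _ _) hn) P fun i => ?_⟩
  exact lowDeg_mono (by rw [one_mul]; exact hn₂ n (le_trans (le_max_right _ _) hn)) (hP i)

end Summit.QuantumAdvantage.AdviceFreeQNC0

end
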